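import Summits.Ventures.Crystal3D.Bulk.GapVertexStar
import Summits.Ventures.Crystal3D.Bulk.GapTightDegree
import Summits.Ventures.Crystal3D.Bulk.GapCensusRows
import HarnessLib

/-!
# The vertex star of the two-level tight graph, II: every gap `< π` at a reduced extremal
# configuration (P-L2(a) in the LP's currency) and the packaged vertex rows

HONEST FRAMING. Part of the venture `Summits/Ventures/Crystal3D` (cell `pub-crystal3d`, phase 2,
24-hour sprint `PLAN.md` R42/R43; seat typer-bulk-2). Continuation of `Bulk/GapVertexStar.lean`
(cyclic order `tightNbrAt`, gaps `tightGap`, `sum_tightGap = 2π`, `tightGap_eq_corner`). Here: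

* `cos_sub_bisector_nonpos` — the real-variable core of the tree's `gapAngle_lt_pi`
  (`Literature…SphericalCodeVertexStar`): for sorted angles in `(−π, π]` and a cyclic gap `≥ π`,
  every angle is at cosine `≤ 0` from the gap's bisector;
* `IsGapConfig.inner_tangentDir_nonpos_of_pi_le_tightGap` — so a reflex gap at ball `i` puts all
  tight partners of `i` in the closed negative half-plane of the bisector tangent direction;
* **`IsReducedExtremal.tightGap_lt_pi`** (shell ball, via `IsReducedExtremal.exists_inner_pos`,
  `Bulk/GapNoHalfPlane.lean`) and **`IsExtremal.tightGap_lt_pi_intruder`** (the hole, via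
  `IsExtremal.exists_inner_pos_intruder`, `Bulk/GapIntruderStar.lean`): EVERY GAP IS `< π` —
  DESIGN-L12-THEORY P-L2(a) "all face corners `< 180°`" in the census LP's own variables;
* packaged vertex rows `IsReducedExtremal.vertexStar`, `IsExtremal.vertexStar_intruder`: at a
  vertex with `d ≥ 1` tight partners the `d` gaps are each `< π`, sum to `2π` (R-sum), and each
  equals the corner between its two consecutive partners (so R-min / R-tri of
  `Bulk/GapCorners.lean` bound it); the degree rows in this vocabulary
  (`IsReducedExtremal.card_tightNbrs_shell`, `IsExtremal.card_tightNbrs_intruder`) and the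
  one-statement VERTEX LP BLOCK `IsReducedExtremal.vertexBlock` (`d ∈ {3,4,5}` gaps, each `< π`
  and `=` corner, `Σ = 2π`);
* non-vacuity: `exists_isReducedExtremal_intruderDist_le` (reduced extremal configurations EXIST,
  with `D ≤ 7√3/9`, from the Conjecture-H configuration of `Bulk/IntruderWitness.lean`),
  `IsExtremal.intruderDist_le_intruder_witness` (`ρ* ≥ 47.66°` in kernel form).

All for configurations with `intruderDist² < 3` (the census window has `D ≤ 1.26`). Nothing is
claimed about GAP(1.26); faces are NOT constructed here.
-/

noncomputable section

open scoped BigOperators InnerProductSpace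
open Finset Real

namespace Summit.Ventures.Crystal3D

open Literature.Geometry.DiscreteGeometry

variable {c : Fin 14 → EuclideanSpace ℝ (Fin 3)}

/-! ## Every gap is `< π` at a reduced extremal configuration (P-L2(a) in gap form) -/

/-- **Bisector lemma** (the real-variable core of the tree's `gapAngle_lt_pi`): for strictly
sorted angles `e₀ < ⋯ < e_k` in `(−π, π]` and a cyclic gap `g_m ≥ π`, every `e_{k'}` makes an
angle with the bisector direction `φ = e_m + g_m/2` whose cosine is `≤ 0`. -/
theorem cos_sub_bisector_nonpos {k : ℕ} (e : Fin (k + 1) → ℝ) (hmono : StrictMono e)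
    (hlo : ∀ m, -π < e m) (hhi : ∀ m, e m ≤ π) (m : Fin (k + 1))
    (hge : π ≤ e (finRotate (k + 1) m) - e m + if m = Fin.last k then 2 * π else 0)
    (k' : Fin (k + 1)) :
    Real.cos (e k' - (e m +
      (e (finRotate (k + 1) m) - e m + if m = Fin.last k then 2 * π else 0) / 2)) ≤ 0 := by
  by_cases hml : m = Fin.last k
  · -- wrap-around gap
    rw [if_pos hml] at hge ⊢
    rw [hml, finRotate_last] at hge ⊢
    have h1 : e 0 ≤ e k' := hmono.monotone (Fin.zero_le _)
    have h2 : e k' ≤ e (Fin.last k) := hmono.monotone (Fin.le_last _)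
    rw [← Real.cos_add_two_pi]
    apply Real.cos_nonpos_of_pi_div_two_le_of_le
    · linarith
    · linarith
  · rw [if_neg hml, add_zero] at hge ⊢
    have hlt : m < Fin.last k := lt_of_le_of_ne (Fin.le_last m) hml
    rw [finRotate_apply] at hge ⊢
    have hval : (m + 1 : Fin (k + 1)).val = m.val + 1 := Fin.val_add_one_of_lt hlt
    rcases le_or_gt k' m with hkm | hkm
    · have h1 : e k' ≤ e m := hmono.monotone hkm
      have h2 : -π < e k' := hlo k'
      have h3 : e (m + 1) ≤ π := hhi (m + 1)
      rw [← Real.cos_add_two_pi]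
      apply Real.cos_nonpos_of_pi_div_two_le_of_le
      · linarith
      · linarith
    · have hle : m + 1 ≤ k' := by
        rw [Fin.le_iff_val_le_val, hval]; exact hkm
      have h1 : e (m + 1) ≤ e k' := hmono.monotone hle
      have h2 : e k' ≤ π := hhi k'
      have h3 : -π < e m := hlo m
      apply Real.cos_nonpos_of_pi_div_two_le_of_le
      · linarith
      · linarith

/-- A recentred centre is its norm times its direction. -/
theorem IsGapConfig.sub_eq_norm_smul_gapDir (hc : IsGapConfig c) {j : Fin 14} (hj0 : j ≠ 0) :
    c j - c 0 = ‖c j - c 0‖ • gapDir c j := by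
  have hne : c j - c 0 ≠ 0 := sub_ne_zero.2 fun h => hj0 (hc.injective h)
  unfold gapDir
  rw [smul_smul, mul_inv_cancel₀ (norm_ne_zero_iff.2 hne), one_smul]

/-- **All tight partners in the closed negative half-plane of the bisector of a reflex gap.** If a
gap `g_m` around ball `i` is `≥ π`, the tangent direction `n` at azimuth `e_m + g_m/2` has
`⟪n, c j − c 0⟫ ≤ 0` for every tight partner `j` of `i`. -/
theorem IsGapConfig.inner_tangentDir_nonpos_of_pi_le_tightGap (hc : IsGapConfig c)
    {i : Fin 14} (hi0 : i ≠ 0) {k : ℕ}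
    (hd : (tightAngles c i).card = k + 1) (m : Fin (k + 1)) (hge : π ≤ tightGap c i hd m)
    {j : Fin 14} (hj : j ∈ tightNbrs c i) :
    ⟪tangentDir (gapDir c i) (hc.norm_gapDir hi0)
        (sortedTightAngle c i hd m + tightGap c i hd m / 2), c j - c 0⟫_ℝ ≤ 0 := by
  have hj0 := (mem_tightNbrs.1 hj).1
  obtain ⟨k', hk'⟩ := exists_sortedTightAngle_eq c i hd hj
  rw [hc.sub_eq_norm_smul_gapDir hj0, real_inner_smul_right]
  refine mul_nonpos_of_nonneg_of_nonpos (norm_nonneg _) ?_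
  rw [inner_tangentDir (hc.norm_gapDir hj0) (rfl : ⟪gapDir c i, gapDir c j⟫_ℝ = _),
    ← hc.tightAzimuth_eq hi0, ← hk']
  refine mul_nonpos_of_nonneg_of_nonpos (Real.sqrt_nonneg _) ?_
  exact cos_sub_bisector_nonpos (sortedTightAngle c i hd) (sortedTightAngle c i hd).strictMono
    (fun m' => (sortedTightAngle_mem c i hd m').1) (fun m' => (sortedTightAngle_mem c i hd m').2)
    m hge k'

/-- **P-L2(a) in gap form at a shell ball: every gap is `< π`.** At a reduced extremal
configuration, around every shell ball `i` with at least one tight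
partner, each gap between cyclically consecutive tight arcs is `< π` (no reflex corner; the
tight partners are in no closed tangent half-plane, `IsReducedExtremal.exists_inner_pos`). -/
theorem IsReducedExtremal.tightGap_lt_pi (hc : IsReducedExtremal c)
    {i : Fin 14} (hi0 : i ≠ 0) (hi13 : i ≠ 13) {k : ℕ} (hd : (tightAngles c i).card = k + 1)
    (m : Fin (k + 1)) : tightGap c i hd m < π := by
  have hg : IsGapConfig c := hc.1.1
  by_contra hge
  push Not at hge
  set φ := sortedTightAngle c i hd m + tightGap c i hd m / 2 with hφ
  have htight : ∃ j : Fin 14, j ≠ 0 ∧ j ≠ i ∧ dist (c i) (c j) = 1 :=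
    ⟨tightNbrAt c i hd m, mem_tightNbrs.1 (tightNbrAt_mem c i hd m)⟩
  have hnt : ⟪c i - c 0, tangentDir (gapDir c i) (hg.norm_gapDir hi0) φ⟫_ℝ = 0 := by
    rw [← hg.gapDir_of_shell hi0 hi13]; exact inner_tangentDir_self φ
  obtain ⟨j, hj0, hji, hdij, hpos⟩ :=
    hc.exists_inner_pos hi0 hi13 htight (tangentDir_ne_zero φ) hnt
  have hle := hg.inner_tangentDir_nonpos_of_pi_le_tightGap hi0 hd m hge
    (mem_tightNbrs.2 ⟨hj0, hji, hdij⟩)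
  exact absurd hle (not_le.2 hpos)

/-- **P-L2(a) in gap form at the hole: every gap is `< π`.** At an extremal configuration,
around the hole direction each gap between cyclically consecutive hole contacts is `< π`
(`IsExtremal.exists_inner_pos_intruder`). -/
theorem IsExtremal.tightGap_lt_pi_intruder (hc : IsExtremal c)
    {k : ℕ} (hd : (tightAngles c 13).card = k + 1) (m : Fin (k + 1)) :
    tightGap c 13 hd m < π := by
  have hg : IsGapConfig c := hc.1
  have h13 : (13 : Fin 14) ≠ 0 := by decide
  by_contra hge
  push Not at hge
  set φ := sortedTightAngle c 13 hd m + tightGap c 13 hd m / 2 with hφ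
  have hnt : ⟪c 13 - c 0, tangentDir (gapDir c 13) (hg.norm_gapDir h13) φ⟫_ℝ = 0 := by
    rw [hg.sub_eq_intruderDist_smul, real_inner_smul_left]
    exact mul_eq_zero_of_right _ (inner_tangentDir_self φ)
  obtain ⟨j, hj0, hj13, hdj, hpos⟩ := hc.exists_inner_pos_intruder (tangentDir_ne_zero φ) hnt
  have hle := hg.inner_tangentDir_nonpos_of_pi_le_tightGap h13 hd m hge
    (mem_tightNbrs.2 ⟨hj0, hj13, hdj⟩)
  exact absurd hle (not_le.2 hpos)

/-! ## The vertex star, packaged (rows R-sum, P-L2(a), R-min at one vertex) -/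

/-- **The vertex star of a shell ball at a reduced extremal configuration** (`intruderDist² < 3`,
ball `i ∉ {0, 13}` with `d = k + 1 ≥ 1` tight partners): the `d` gaps between cyclically
consecutive tight arcs are each `< π`, sum to `2π`, and — when `d ≥ 2` — each gap equals the
corner `corner c i j' j` between its two (distinct) partners, to which the rows R-min / R-tri of
`Bulk/GapCorners.lean` apply. -/
theorem IsReducedExtremal.vertexStar (hc : IsReducedExtremal c) (hD3 : intruderDist c ^ 2 < 3)
    {i : Fin 14} (hi0 : i ≠ 0) (hi13 : i ≠ 13) {k : ℕ} (hd : (tightAngles c i).card = k + 1) :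
    (∀ m, tightGap c i hd m < π ∧
      tightGap c i hd m = corner c i (tightNbrAt c i hd (finRotate (k + 1) m)) (tightNbrAt c i hd m))
      ∧ ∑ m, tightGap c i hd m = 2 * π :=
  ⟨fun m => ⟨hc.tightGap_lt_pi hi0 hi13 hd m,
    hc.1.1.tightGap_eq_corner hD3 hi0 hd m (hc.tightGap_lt_pi hi0 hi13 hd m).le⟩,
    sum_tightGap c i hd⟩

/-- **The vertex star of the hole at an extremal configuration** (`intruderDist² < 3`): the gaps
between cyclically consecutive hole contacts are each `< π`, sum to `2π`, and each equals the
corner `corner c 13 j' j` between its two partners (R-min there: `≥ A_p(ρ)`,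
`IsGapConfig.arccos_Ap_le_corner`). -/
theorem IsExtremal.vertexStar_intruder (hc : IsExtremal c) (hD3 : intruderDist c ^ 2 < 3) {k : ℕ}
    (hd : (tightAngles c 13).card = k + 1) :
    (∀ m, tightGap c 13 hd m < π ∧
      tightGap c 13 hd m =
        corner c 13 (tightNbrAt c 13 hd (finRotate (k + 1) m)) (tightNbrAt c 13 hd m))
      ∧ ∑ m, tightGap c 13 hd m = 2 * π :=
  ⟨fun m => ⟨hc.tightGap_lt_pi_intruder hd m,
    hc.1.tightGap_eq_corner hD3 (by decide) hd m (hc.tightGap_lt_pi_intruder hd m).le⟩,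
    sum_tightGap c 13 hd⟩

/-! ## The degree rows in the vertex-star vocabulary -/

/-- The degree rows of `Bulk/GapTightDegree.lean` / `Bulk/GapDegreesSharp.lean` count exactly
`tightNbrs`: at a reduced extremal configuration with `intruderDist² < 12/7`, a shell ball with a
tight partner has `3 ≤ #tightNbrs ≤ 5`. -/
theorem IsReducedExtremal.card_tightNbrs_shell (hc : IsReducedExtremal c)
    (hD : intruderDist c ^ 2 < 12 / 7) {i : Fin 14} (hi0 : i ≠ 0) (hi13 : i ≠ 13)
    (hne : (tightNbrs c i).Nonempty) :
    3 ≤ (tightNbrs c i).card ∧ (tightNbrs c i).card ≤ 5 := by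
  obtain ⟨j, hj⟩ := hne
  exact ⟨hc.three_le_card_tight hi0 hi13 ⟨j, mem_tightNbrs.1 hj⟩,
    hc.1.1.card_tight_le_five hi0 hi13 hD⟩

/-- At an extremal configuration with `intruderDist < 2` the hole has `3 ≤ #tightNbrs ≤ 5`
contacts, and `≤ 4` when `1.0515 ≤ intruderDist` (hole radius `≤ 58.28°`). -/
theorem IsExtremal.card_tightNbrs_intruder (hc : IsExtremal c) (hD2 : intruderDist c < 2) :
    3 ≤ (tightNbrs c 13).card ∧ (tightNbrs c 13).card ≤ 5 ∧
      ((1.0515 : ℝ) ≤ intruderDist c → (tightNbrs c 13).card ≤ 4) := by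
  have h3 := hc.three_le_card_intruderContacts
  have h5 := hc.1.card_intruderContacts_le_five hD2
  have h4 := fun hlo : (1.0515 : ℝ) ≤ intruderDist c => hc.1.card_intruderContacts_le_four_of_le hlo hD2
  -- the degree rows count `dist (c 13) (c j) = 1` with `j ≠ 0 ∧ j ≠ 13`; `tightNbrs c 13` is the
  -- same finset
  have hset : (univ.filter fun j : Fin 14 => j ≠ 0 ∧ j ≠ 13 ∧ dist (c 13) (c j) = 1) =
      tightNbrs c 13 := rfl
  rw [hset] at h3 h5 h4
  exact ⟨h3, h5, h4⟩

/-- **The vertex LP block at a shell ball**, everything in one statement: at a reduced extremal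
configuration with `intruderDist² < 12/7` (`D < 1.309`, the census window), a shell ball `i` with
a tight partner has `d ∈ {3, 4, 5}` tight partners; with `hd : #tightAngles = k + 1` (and
`#tightAngles = #tightNbrs`, `IsGapConfig.card_tightAngles`), its `k + 1` gaps are each `< π`,
each equal to the corner between consecutive partners, and sum to `2π`. -/
theorem IsReducedExtremal.vertexBlock (hc : IsReducedExtremal c) (hD : intruderDist c ^ 2 < 12 / 7)
    {i : Fin 14} (hi0 : i ≠ 0) (hi13 : i ≠ 13) {k : ℕ} (hd : (tightAngles c i).card = k + 1) :
    (3 ≤ k + 1 ∧ k + 1 ≤ 5) ∧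
      (∀ m, tightGap c i hd m < π ∧
        tightGap c i hd m =
          corner c i (tightNbrAt c i hd (finRotate (k + 1) m)) (tightNbrAt c i hd m)) ∧
      ∑ m, tightGap c i hd m = 2 * π := by
  have hD3 : intruderDist c ^ 2 < 3 := by linarith
  have hcard : (tightNbrs c i).card = k + 1 := by
    rw [← hc.1.1.card_tightAngles hD3 hi0]; exact hd
  have hne : (tightNbrs c i).Nonempty := by
    rw [← Finset.card_pos, hcard]; exact Nat.succ_pos k
  have hdeg := hc.card_tightNbrs_shell hD hi0 hi13 hne
  rw [hcard] at hdeg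
  exact ⟨hdeg, hc.vertexStar hD3 hi0 hi13 hd⟩

/-! ## Non-vacuity: reduced extremal configurations exist (hole radius `ρ* ≥ 47.66°`) -/

/-- **Reduced extremal configurations exist**, with intruder distance at most that of the
Conjecture-H configuration, `7√3/9 = 1.3471…` (i.e. the extremal hole radius satisfies
`ρ* ≥ arccos (7√3/18) = 47.66°`): the statements of this file and of `Bulk/GapCensusRows.lean`
about (reduced) extremal configurations are not about the empty set. Whether some reduced
extremal configuration has `intruderDist ≤ 1.26` is exactly the negation of GAP(1.26)
(`not_gapTupleDiam_iff_exists_isReducedExtremal`). -/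
theorem exists_isReducedExtremal_intruderDist_le :
    ∃ c : Fin 14 → EuclideanSpace ℝ (Fin 3),
      IsReducedExtremal c ∧ intruderDist c ≤ 7 * Real.sqrt 3 / 9 :=
  exists_isReducedExtremal ⟨Intruder.pt, Intruder.isGapConfig_pt, Intruder.intruderDist_pt.le⟩

/-- Hence every extremal configuration has `intruderDist ≤ 7√3/9 < 1.3472` (all extremal
configurations share the same intruder distance). -/
theorem IsExtremal.intruderDist_le_intruder_witness (hc : IsExtremal c) :
    intruderDist c ≤ 7 * Real.sqrt 3 / 9 :=
  (hc.2 Intruder.pt Intruder.isGapConfig_pt).trans Intruder.intruderDist_pt.le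

end Summit.Ventures.Crystal3D
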